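import Literature.NumberTheory.Automorphic.HilbertRepIsotypicComponent
import HarnessLib

/-!
# Subrepresentations of an isotypic component, the discrete part as the closed span of the
# components, and weight vectors in invariant subspaces meeting a component
(Deitmar–Echterhoff, *Principles of Harmonic Analysis* (2014), Cor. 6.1.9 and §7.3 Thm. 7.3.2;
Dixmier, *C\*-algebras* (1977), §5.4)

Topic `NumberTheory/Automorphic`; theorems and one definition, no named fact, no instance,
continuing `HilbertRepIsotypicComponent` (`isotypicMembers`, `isotypicComponent`) for a unitary
representation `π` of a group `G` on a complex Hilbert space `H` and a representation `σ` on a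
Hilbert space `H'`. Writing `H_σ = π.isotypicComponent σ`:

* `exists_isotypicMember_le` — **every non-zero closed invariant subspace `N ≤ H_σ` contains an
  irreducible closed subrepresentation unitarily equivalent to `σ`**: some member `W ≃ σ` is not
  inside `Nᗮ` (else `H_σ ≤ Nᗮ`, forcing `N = 0`), and the isometric part of the compressed
  projection `P_N|_W` (the tree's `ClosedSubrep.exists_le_orthogonal_areUnitarilyEquivalent`,
  Deitmar–Echterhoff Cor. 6.1.9) embeds `W` equivariantly into `Nᗮᗮ = N`. This is the step of
  the proof of Thm. 7.3.2 (b) (`V_π(τ)` is a Hilbert sum of copies of `V_τ`) that survives for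
  arbitrary `G`.
* `areUnitarilyEquivalent_of_le_isotypicComponent` — an irreducible closed subrepresentation
  contained in `H_σ` is equivalent to `σ` (it lies in its own component, which is orthogonal to
  `H_σ` otherwise, `isotypicComponent_le_orthogonal`).
* `discretePart_eq_iSupClosure_isotypicComponent` — the discrete part `H_disc` (closed span of
  all irreducible closed subrepresentations, `discretePart`) is the closed span of the isotypic
  components `H_{W}` of its irreducible `W` (Dixmier (1977), §5.4: `H_disc = ⊕̂ H_σ`; only the
  closed-span form is recorded, orthogonality being `isOrtho_isotypicComponent`).
* `weightSpace π ι w = ⋂_t ker (π (ι t) - w t)` — the joint eigenspace ("weight space") of a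
  family of group elements `ι : T → G` with eigenvalues `w : T → ℂ`; closed; transported by
  equivalences (`mem_weightSpace_equiv`) and computed in subrepresentations
  (`ClosedSubrep.mem_weightSpace_toContRep`).
* `exists_mem_weightSpace_of_inf_isotypicComponent_ne_bot` — **weight vectors descend to
  invariant subspaces**: if the weight `w` occurs in `σ` (`σ.weightSpace ι w ≠ ⊥`) then every
  closed invariant subspace `M` with `M ∩ H_σ ≠ 0` contains a non-zero `w`-weight vector lying in
  `M ∩ H_σ` — by `exists_isotypicMember_le` applied to `M ∩ H_σ` and transport of a weight
  vector of `σ` along the unitary equivalence. (Typical use: `ι` a family of elements of a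
  compact torus acting through characters; the lemma says that an invariant subspace which sees
  the `σ`-isotypic part also sees its `w`-weight vectors.)

## Mathlib

`Module.End.eigenspace`, `Submodule.mem_iInf`, `ContRepresentation.Equiv` (with
`ContIntertwiningMap.isIntertwining`), `Submodule.exists_mem_ne_zero_of_ne_bot`; no Mathlib
declaration is duplicated (Mathlib has weight spaces of Lie algebra modules,
`LieModule.weightSpace`, not of group representations on topological vector spaces).

## Design notes

* As in `HilbertRepSpectrum` / `HilbertRepIsotypicComponent`, the declarations are DELIBERATE
  dot-notation extensions in `namespace ContRepresentation` (`π.weightSpace ι w`,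
  `ClosedSubrep.mem_weightSpace_toContRep`); nothing else enters a Mathlib namespace.
* `weightSpace` is defined for any `ContRepresentation` over a commutative ring on a topological
  module; closedness needs `T2Space` and continuous scalar multiplication; the isotypic
  statements are for complex Hilbert spaces and unitary `π`.
* Provenance. Generic layer re-proved over the tree's vocabulary so that the problem-specific
  files of the adjudication package of the 2001 Hodge/CM manuscripts (`HodgeCM.RepDecomp`,
  `Automorphic/IsotypicDecomposition.lean` §6 there: `Ew`, `WOccurs`, `exists_wvector`) can
  import the tree; nothing here is a claim of those manuscripts.

## References

* A. Deitmar, S. Echterhoff, *Principles of Harmonic Analysis*, 2nd ed., Universitext, Springer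
  (2014): Cor. 6.1.9 (PDF p. 175); §7.3 *Isotypes*, Thm. 7.3.2 (printed pp. 142–143)
  [DeitmarEchterhoff2014].
* J. Dixmier, *C\*-algebras*, North-Holland (1977), §5.4 [Dixmier1977].
-/

noncomputable section

open scoped InnerProductSpace
open Topology

namespace ContRepresentation

/-! ### Weight spaces of a family of group elements -/

section Weight

variable {R G V V' : Type*} [CommRing R] [Monoid G]
  [AddCommGroup V] [Module R V] [TopologicalSpace V] [IsTopologicalAddGroup V]
  [AddCommGroup V'] [Module R V'] [TopologicalSpace V'] [IsTopologicalAddGroup V']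

/-- The *joint eigenspace* (weight space) of the operators `π (ι t)`, `t : T`, for the
eigenvalues `w t`: `{v | ∀ t, π (ι t) v = w t • v}` (Mathlib `Module.End.eigenspace`,
intersected over `t`). [folklore] -/
def weightSpace (π : ContRepresentation R G V) {T : Type*} (ι : T → G) (w : T → R) :
    Submodule R V :=
  ⨅ t, Module.End.eigenspace ((π (ι t) : V →L[R] V) : V →ₗ[R] V) (w t)

variable {π : ContRepresentation R G V} {π' : ContRepresentation R G V'} {T : Type*} {ι : T → G}
  {w : T → R}

/-- Membership in the weight space: `π (ι t) v = w t • v` for every `t`. [folklore] -/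
theorem mem_weightSpace {v : V} : v ∈ π.weightSpace ι w ↔ ∀ t, π (ι t) v = w t • v := by
  simp only [weightSpace, Submodule.mem_iInf, Module.End.mem_eigenspace_iff]
  rfl

/-- The weight space is closed (an intersection of kernels of continuous maps). [folklore] -/
theorem isClosed_weightSpace [T2Space V] [ContinuousConstSMul R V] :
    IsClosed (π.weightSpace ι w : Set V) := by
  have h : (π.weightSpace ι w : Set V) = ⋂ t, {v : V | π (ι t) v = w t • v} := by
    ext v
    simp only [SetLike.mem_coe, mem_weightSpace, Set.mem_iInter, Set.mem_setOf_eq]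
  rw [h]
  exact isClosed_iInter fun t =>
    isClosed_eq (π (ι t)).continuous (continuous_id.const_smul (w t))

/-- An equivalence of representations identifies the weight spaces. [folklore] -/
theorem mem_weightSpace_equiv (e : π.Equiv π') {v : V} :
    e v ∈ π'.weightSpace ι w ↔ v ∈ π.weightSpace ι w := by
  simp only [mem_weightSpace]
  have he : ∀ t, e (π (ι t) v) = π' (ι t) (e v) := fun t => by
    simpa only [Equiv.coe_toContIntertwiningMap] using
      e.toContIntertwiningMap.isIntertwining (ι t) v
  refine ⟨fun h t => ?_, fun h t => ?_⟩
  · have h1 : e (π (ι t) v) = e (w t • v) := by rw [he t, h t, map_smul]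
    exact e.injective h1
  · rw [← he t, h t, map_smul]

/-- Weight vectors of a closed subrepresentation are the weight vectors of `π` lying in it.
[folklore] -/
theorem ClosedSubrep.mem_weightSpace_toContRep (W : ClosedSubrep π) {v : W.toSubmodule} :
    v ∈ W.toContRep.weightSpace ι w ↔ (v : V) ∈ π.weightSpace ι w := by
  simp only [mem_weightSpace]
  refine ⟨fun h t => ?_, fun h t => Subtype.ext ?_⟩
  · rw [← ClosedSubrep.coe_toContRep_apply, h t, Submodule.coe_smul]
  · rw [ClosedSubrep.coe_toContRep_apply, h t, Submodule.coe_smul]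

end Weight

/-! ### Subrepresentations of an isotypic component -/

section Hilbert

variable {G H H' : Type*} [Group G]
  [NormedAddCommGroup H] [InnerProductSpace ℂ H] [CompleteSpace H]
  [NormedAddCommGroup H'] [InnerProductSpace ℂ H']
  {π : ContRepresentation ℂ G H} {σ : ContRepresentation ℂ G H'}

/-- **A non-zero closed invariant subspace of the `σ`-isotypic component contains an irreducible
closed subrepresentation unitarily equivalent to `σ`.** Some member `W ≃ σ` of the class is not
contained in `Nᗮ` (otherwise `H_σ ≤ Nᗮ` and `N ≤ H_σ` give `N = 0`); the isometric part of the
compression of `P_N` to `W` (`ClosedSubrep.exists_le_orthogonal_areUnitarilyEquivalent`,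
Deitmar–Echterhoff (2014), Cor. 6.1.9) embeds `W` into `Nᗮᗮ = N`.
[cite: DeitmarEchterhoff2014, Cor. 6.1.9] -/
theorem exists_isotypicMember_le (hπ : π.IsUnitary) {N : ClosedSubrep π}
    (hN : N ≤ π.isotypicComponent σ) (hN0 : N ≠ ⊥) :
    ∃ W ∈ π.isotypicMembers σ, W ≤ N := by
  -- some member of the class is not inside `Nᗮ`
  have h : ∃ W ∈ π.isotypicMembers σ, ¬ W ≤ N.orthogonal hπ := by
    by_contra hall
    push Not at hall
    apply hN0
    have hle : π.isotypicComponent σ ≤ N.orthogonal hπ :=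
      isotypicComponent_le fun W hW he => hall W ⟨hW, he⟩
    exact ClosedSubrep.eq_bot_of_le_of_le_orthogonal hπ le_rfl (hN.trans hle)
  obtain ⟨W, hW, hWle⟩ := h
  obtain ⟨W'', hW''le, heq⟩ :=
    ClosedSubrep.exists_le_orthogonal_areUnitarilyEquivalent hπ (N.orthogonal hπ) W hW.1 hWle
  rw [ClosedSubrep.orthogonal_orthogonal] at hW''le
  have hirr : W''.toContRep.IsTopIrreducible := by
    obtain ⟨e, -⟩ := heq
    exact (isTopIrreducible_congr e).mp hW.1
  exact ⟨W'', ⟨hirr, heq.symm.trans hW.2⟩, hW''le⟩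

/-- **An irreducible closed subrepresentation inside `H_σ` is unitarily equivalent to `σ`**: it
lies in its own isotypic component, which would be orthogonal to `H_σ` otherwise
(`isotypicComponent_le_orthogonal`). [cite: DeitmarEchterhoff2014, Cor. 6.1.9] -/
theorem areUnitarilyEquivalent_of_le_isotypicComponent (hπ : π.IsUnitary) {W : ClosedSubrep π}
    (hW : W.toContRep.IsTopIrreducible) (hle : W ≤ π.isotypicComponent σ) :
    AreUnitarilyEquivalent W.toContRep σ := by
  by_contra hne
  apply ClosedSubrep.ne_bot_of_isTopIrreducible hW
  have h₁ : W ≤ π.isotypicComponent W.toContRep :=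
    le_isotypicComponent hW (AreUnitarilyEquivalent.refl _)
  have h₂ : π.isotypicComponent σ ≤ (π.isotypicComponent W.toContRep).orthogonal hπ :=
    isotypicComponent_le_orthogonal hπ fun h => hne h.symm
  exact ClosedSubrep.eq_bot_of_le_of_le_orthogonal hπ h₁ (hle.trans h₂)

/-- The members of the class of `σ` are exactly the irreducible closed subrepresentations
contained in `H_σ` (for unitary `π`). [cite: DeitmarEchterhoff2014, Cor. 6.1.9] -/
theorem mem_isotypicMembers_iff_le (hπ : π.IsUnitary) {W : ClosedSubrep π} :
    W ∈ π.isotypicMembers σ ↔ W.toContRep.IsTopIrreducible ∧ W ≤ π.isotypicComponent σ :=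
  ⟨fun h => ⟨h.1, le_isotypicComponent h.1 h.2⟩,
    fun h => ⟨h.1, areUnitarilyEquivalent_of_le_isotypicComponent hπ h.1 h.2⟩⟩

omit [CompleteSpace H] in
/-- **The discrete part is the closed span of the isotypic components** of the irreducible
closed subrepresentations (Dixmier (1977), §5.4, closed-span form of `H_disc = ⊕̂_σ H_σ`).
[cite: Dixmier1977, §5.4] -/
theorem discretePart_eq_iSupClosure_isotypicComponent :
    π.discretePart = ClosedSubrep.iSupClosure
      {N | ∃ W : ClosedSubrep π, W.toContRep.IsTopIrreducible ∧
        N = π.isotypicComponent W.toContRep} := by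
  apply le_antisymm
  · exact ClosedSubrep.iSupClosure_le fun W hW =>
      (le_isotypicComponent hW (AreUnitarilyEquivalent.refl _)).trans
        (ClosedSubrep.le_iSupClosure ⟨W, hW, rfl⟩)
  · refine ClosedSubrep.iSupClosure_le ?_
    rintro N ⟨W, -, rfl⟩
    exact isotypicComponent_le_discretePart

/-! ### Weight vectors in invariant subspaces meeting an isotypic component -/

/-- **Weight vectors descend to invariant subspaces meeting `H_σ`.** Let `π` be unitary and let
the weight `w` of the family `ι` occur in `σ` (`σ.weightSpace ι w ≠ ⊥`). If a closed invariant
subspace `M` meets the `σ`-isotypic component non-trivially, then `M ∩ H_σ` contains a non-zero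
`w`-weight vector of `π`: `M ∩ H_σ` contains a member `W ≃ σ` (`exists_isotypicMember_le`), and
the unitary equivalence carries a non-zero weight vector of `σ` to one of `W`
(`mem_weightSpace_equiv`, `ClosedSubrep.mem_weightSpace_toContRep`). [folklore] -/
theorem exists_mem_weightSpace_of_inf_isotypicComponent_ne_bot (hπ : π.IsUnitary) {T : Type*}
    {ι : T → G} {w : T → ℂ} (hw : σ.weightSpace ι w ≠ ⊥) (M : ClosedSubrep π)
    (hM : M.toSubmodule ⊓ (π.isotypicComponent σ).toSubmodule ≠ ⊥) :
    ∃ v ∈ M, v ∈ π.isotypicComponent σ ∧ v ≠ 0 ∧ v ∈ π.weightSpace ι w := by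
  -- the closed invariant subspace `N = M ∩ H_σ`
  set N : ClosedSubrep π := ClosedSubrep.ofSubmodule
    (M.toSubmodule ⊓ (π.isotypicComponent σ).toSubmodule)
    (by
      rw [Submodule.coe_inf]
      exact M.isClosed.inter (π.isotypicComponent σ).isClosed)
    (fun g v hv => ⟨M.apply_mem g hv.1, (π.isotypicComponent σ).apply_mem g hv.2⟩) with hNdef
  have hNle : N ≤ π.isotypicComponent σ := fun v hv => hv.2
  have hN0 : N ≠ ⊥ := by
    intro h
    apply hM
    rw [Submodule.eq_bot_iff]
    intro v hv
    have hv' : v ∈ N := hv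
    rw [h, ClosedSubrep.mem_bot] at hv'
    exact hv'
  obtain ⟨W, hW, hWN⟩ := exists_isotypicMember_le hπ hNle hN0
  obtain ⟨e, -⟩ := hW.2
  -- a non-zero weight vector of `σ`, transported to `W`
  obtain ⟨v₀, hv₀, hv₀0⟩ := Submodule.exists_mem_ne_zero_of_ne_bot hw
  set u : W.toSubmodule := e.symm v₀ with hu
  have huw : u ∈ W.toContRep.weightSpace ι w := by
    rw [← mem_weightSpace_equiv e]
    have : e u = v₀ := by rw [hu]; exact e.toContinuousLinearEquiv.apply_symm_apply v₀
    rw [this]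
    exact hv₀
  have hu0 : (u : H) ≠ 0 := by
    intro h0
    apply hv₀0
    have hu' : u = 0 := Subtype.ext h0
    have : e u = v₀ := by rw [hu]; exact e.toContinuousLinearEquiv.apply_symm_apply v₀
    rw [← this, hu', map_zero]
  refine ⟨u, (hWN u.2).1, (hWN u.2).2, hu0, ?_⟩
  exact (ClosedSubrep.mem_weightSpace_toContRep W).mp huw

end Hilbert

end ContRepresentation

end
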